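import Mathlib
import Summits.ResolutionOfSingularities.ResolutionOfSingularities.Theorems.WeightedInvariantLocalWeightedDropNCGameRank

/-!
# `LocalWeightedDrop`, the NC count game: **A DECORATED (HISTORY-DEPENDENT) RANK THAT DROPS YIELDS A POSITIONAL RANK THAT DROPS**

[OURS · L1 W4.3 · chain w43, engine crux `LocalWeightedDrop` stmt-ResolutionOfSingularities-8899; game-theoretic plumbing for the
v32 residual `stub_spaceNCRankDrop` (res-L1-w43-lead-1, `…NCGameRank` p525270 / `…NCGameRankTupleDrop`): the positional interface
«ONE ordinal rank `ρ` on germs, lowered at every exceptional point of some smooth-centre move» is implied by any DECORATED rank —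
a rank `ι b δ` read on a germ `b` TOGETHER WITH extra bookkeeping `δ` (a boundary with ages and labels, a distinguished equation of
the strict transform, a flag, …: the «resolution settings» of the embedded-surface proofs à la Hironaka / Cossart–Jannsen–Saito /
Hauser–Perlega, whose invariants depend on the history of the process and not on the germ alone), provided every non-terminal germ
admits SOME admissible decoration and from every admissibly decorated non-terminal germ some legal move leads, at every exceptional
point and every factorisation, at some live slot, to a terminal germ or to an admissibly decorated germ of smaller decorated rank.  The
positional rank is `0` on terminal germs and `(inf over admissible decorations) + 1` elsewhere.  Folklore (the attractor rank of a
reachability game forgets the memory of a winning strategy); NOT a statement of any manuscript; closes nothing by name; no definitions.]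

* `TameFourTupleDrop.rankDrop_of_decoratedRank` — THE REDUCTION, dimension- and predicate-generic, in the literal hypothesis shape of
  `winsOrd_of_rankDrop` / `tupleDropThree_of_ncRankDrop` / `stub_spaceNCRankDrop`;
* `TameFourTupleDrop.rankDrop_of_decoratedRank'` — the same with the decorated strategy stated on decorated successors only;
* `TameFourTupleDrop.winsOrd_of_decoratedRank` — hence transfinite winnability of every non-zero germ.
-/

set_option linter.dupNamespace false -- mandated namespace of this single-conjunct summit

noncomputable section

namespace Summit.ResolutionOfSingularities.ResolutionOfSingularities.Theorems

namespace TameFourTupleDrop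

open MvPowerSeries Literature.AlgebraicGeometry.Resolution

variable {k : Type} [Field k] {m : ℕ}

/-- **A DECORATED RANK THAT DROPS YIELDS A POSITIONAL RANK THAT DROPS** (OURS · L1 W4.3; dimension- and predicate-generic).
Data: decorations `δ : Δ` of germs with an admissibility relation `adm b δ` and a decorated ordinal rank `ι b δ`.  Hypotheses:
(`hstart`) every non-zero non-terminal germ has an admissible decoration; (`hstep`) from every non-zero non-terminal germ `b` with an
admissible decoration `δ` some legal move `(Φ, w)` has, at every exceptional point and every factorisation, a live slot whose new
position is terminal or carries an admissible decoration of strictly smaller decorated rank.  Conclusion: ONE ordinal rank on germs drops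
at every exceptional point of some move from every non-zero non-terminal germ — the hypothesis text of `winsOrd_of_rankDrop`, and at
`Fin 3`, `P := GermIsNC` the text of `tupleDropThree_of_ncRankDrop` / the v32 residual `stub_spaceNCRankDrop`.  The strategy behind
`ι` may depend on the whole history carried by `δ`; the extracted rank (`0` on terminal germs, `(⨅ admissible ι) + 1` elsewhere) does
not. -/
theorem rankDrop_of_decoratedRank (P : MvPowerSeries (Fin (m + 1)) k → Prop) {Δ : Type}
    (adm : MvPowerSeries (Fin (m + 1)) k → Δ → Prop) (ι : MvPowerSeries (Fin (m + 1)) k → Δ → Ordinal.{0})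
    (hstart : ∀ b : MvPowerSeries (Fin (m + 1)) k, b ≠ 0 → ¬ P b → ∃ δ, adm b δ)
    (hstep : ∀ (b : MvPowerSeries (Fin (m + 1)) k) (δ : Δ), b ≠ 0 → ¬ P b → adm b δ →
      ∃ (Φ : Fin (m + 1) → MvPowerSeries (Fin (m + 1)) k) (w : Fin (m + 1) → ℕ),
        IsCountMove Φ w ∧ MoveClause b Φ w (fun b' => P b' ∨ ∃ δ', adm b' δ' ∧ ι b' δ' < ι b δ)) :
    ∃ ρ : MvPowerSeries (Fin (m + 1)) k → Ordinal.{0}, ∀ b : MvPowerSeries (Fin (m + 1)) k, b ≠ 0 → ¬ P b →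
      ∃ (Φ : Fin (m + 1) → MvPowerSeries (Fin (m + 1)) k) (w : Fin (m + 1) → ℕ),
        IsCountMove Φ w ∧ MoveClause b Φ w (fun b' => ρ b' < ρ b) := by
  classical
  -- the extracted positional rank: `0` on terminal germs, `(inf of the admissible decorated ranks) + 1` elsewhere
  obtain ⟨ρ, hρ0, hρ1⟩ : ∃ ρ : MvPowerSeries (Fin (m + 1)) k → Ordinal.{0},
      (∀ b, P b → ρ b = 0) ∧ (∀ b, ¬ P b → ρ b = sInf {α | ∃ δ, adm b δ ∧ ι b δ = α} + 1) :=
    ⟨fun b => if P b then 0 else sInf {α | ∃ δ, adm b δ ∧ ι b δ = α} + 1,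
      fun b hb => by simp only [hb, if_true], fun b hb => by simp only [hb, if_false]⟩
  refine ⟨ρ, fun b hb hPb => ?_⟩
  -- an admissible decoration of minimal decorated rank
  obtain ⟨δ₁, hδ₁⟩ := hstart b hb hPb
  have hne : ({α | ∃ δ, adm b δ ∧ ι b δ = α} : Set Ordinal.{0}).Nonempty := ⟨ι b δ₁, δ₁, hδ₁, rfl⟩
  obtain ⟨δ₀, hδ₀, hδ₀eq⟩ := csInf_mem hne
  have hρb : ρ b = ι b δ₀ + 1 := by rw [hρ1 b hPb, hδ₀eq]
  obtain ⟨Φ, w, hmv, hcl⟩ := hstep b δ₀ hb hPb hδ₀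
  refine ⟨Φ, w, hmv, hcl.mono fun b' hb' => ?_⟩
  rw [hρb]
  by_cases hPb' : P b'
  · rw [hρ0 b' hPb']
    exact Order.lt_add_one_iff.mpr bot_le
  · rcases hb' with hP | ⟨δ', hδ', hlt⟩
    · exact absurd hP hPb'
    · have hmem : ι b' δ' ∈ ({α | ∃ δ, adm b' δ ∧ ι b' δ = α} : Set Ordinal.{0}) := ⟨δ', hδ', rfl⟩
      calc ρ b' = sInf {α | ∃ δ, adm b' δ ∧ ι b' δ = α} + 1 := hρ1 b' hPb'
        _ ≤ ι b' δ' + 1 := add_le_add_left (csInf_le' hmem) 1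
        _ ≤ ι b δ₀ := Order.add_one_le_of_lt hlt
        _ < ι b δ₀ + 1 := Order.lt_add_one_iff.mpr le_rfl

/-- THE SAME REDUCTION WHEN THE DECORATED STRATEGY IS STATED ON DECORATED SUCCESSORS ONLY (no terminal escape clause). -/
theorem rankDrop_of_decoratedRank' (P : MvPowerSeries (Fin (m + 1)) k → Prop) {Δ : Type}
    (adm : MvPowerSeries (Fin (m + 1)) k → Δ → Prop) (ι : MvPowerSeries (Fin (m + 1)) k → Δ → Ordinal.{0})
    (hstart : ∀ b : MvPowerSeries (Fin (m + 1)) k, b ≠ 0 → ¬ P b → ∃ δ, adm b δ)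
    (hstep : ∀ (b : MvPowerSeries (Fin (m + 1)) k) (δ : Δ), b ≠ 0 → ¬ P b → adm b δ →
      ∃ (Φ : Fin (m + 1) → MvPowerSeries (Fin (m + 1)) k) (w : Fin (m + 1) → ℕ),
        IsCountMove Φ w ∧ MoveClause b Φ w (fun b' => ∃ δ', adm b' δ' ∧ ι b' δ' < ι b δ)) :
    ∃ ρ : MvPowerSeries (Fin (m + 1)) k → Ordinal.{0}, ∀ b : MvPowerSeries (Fin (m + 1)) k, b ≠ 0 → ¬ P b →
      ∃ (Φ : Fin (m + 1) → MvPowerSeries (Fin (m + 1)) k) (w : Fin (m + 1) → ℕ),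
        IsCountMove Φ w ∧ MoveClause b Φ w (fun b' => ρ b' < ρ b) :=
  rankDrop_of_decoratedRank P adm ι hstart fun b δ hb hPb hδ => by
    obtain ⟨Φ, w, hmv, hcl⟩ := hstep b δ hb hPb hδ
    exact ⟨Φ, w, hmv, hcl.mono fun b' hb' => Or.inr hb'⟩

/-- Hence, under the hypotheses of `rankDrop_of_decoratedRank`, every non-zero germ is transfinitely winnable (`winsOrd_of_rankDrop`). -/
theorem winsOrd_of_decoratedRank (P : MvPowerSeries (Fin (m + 1)) k → Prop) {Δ : Type}
    (adm : MvPowerSeries (Fin (m + 1)) k → Δ → Prop) (ι : MvPowerSeries (Fin (m + 1)) k → Δ → Ordinal.{0})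
    (hstart : ∀ b : MvPowerSeries (Fin (m + 1)) k, b ≠ 0 → ¬ P b → ∃ δ, adm b δ)
    (hstep : ∀ (b : MvPowerSeries (Fin (m + 1)) k) (δ : Δ), b ≠ 0 → ¬ P b → adm b δ →
      ∃ (Φ : Fin (m + 1) → MvPowerSeries (Fin (m + 1)) k) (w : Fin (m + 1) → ℕ),
        IsCountMove Φ w ∧ MoveClause b Φ w (fun b' => P b' ∨ ∃ δ', adm b' δ' ∧ ι b' δ' < ι b δ)) :
    ∀ b : MvPowerSeries (Fin (m + 1)) k, b ≠ 0 → ∃ α, WinsOrd P α b := by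
  obtain ⟨ρ, hρ⟩ := rankDrop_of_decoratedRank P adm ι hstart hstep
  exact winsOrd_of_rankDrop ρ hρ

end TameFourTupleDrop

end Summit.ResolutionOfSingularities.ResolutionOfSingularities.Theorems

end
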